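import Summits.BirchSwinnertonDyer.Rank1Residual.GaloisImage.KolyvaginDerivativeDescent
import HarnessLib

/-!
# Cocycle-level witnesses for the Kolyvagin derivative: the global cocycle behind THEOREM A3 and
# the explicit coboundaries behind THEOREM A2 — file C1 of THEOREM C of row T-DER
# ([Rubin00] Thm. 4.5.4, the finite–singular relation; cell `b2b-bsdres`, team n1011, seat p11
# GEN 8, OWNERS row T-DER = skel/T-DER.md STATUS v8)

HONEST FRAMING (cell `b2b-bsdres`, run/shared/lean/b2b/bsd-rank1-residual/, verbatim in every
file): the goal of the cell is to DELETE the COMBINATION-SHAPED residual classes of the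
Birch–Swinnerton-Dyer formula for ALL analytic-rank `≤ 1` elliptic curves over `ℚ` — "full BSD
formula for every rank `≤ 1` curve in class `C`" assembled STRICTLY from published theorems — so
that the rank-`≤ 1` remainder becomes exactly the CONSTRUCTION-SHAPED classes, which are TYPED
(missing-input `Prop`s), NOT attempted. This is not "finishing BSD". Team n1011: research route on
the CONSTRUCTION-SHAPED class X4 / §I N11 (route-1 PORT, (P-DER)); TOOL theorems of continuous
group cohomology (no definition, no named fact, no `sorry`); curve-free, `p`-free.

## Why

THEOREM C ([Rubin00] Thm. 4.5.4 = [Rubin2011] Thm. 4.3.10 (2) = [PerrinRiou98] §3.1 + Prop. 2.2.5: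
`loc^s_q κ_{rq} = φ^{fs}_q(loc_q κ_r)`) is an identity between VALUES of representative cocycles
(`IsFiniteSingularComparisonWith`: `w(τ) = Q_q(Fr⁻¹)·z(Fr)`), whereas every step of THEOREM A is
`0 = 0` at the level of classes.  Its proof (Nekovář / Perrin-Riou, *Systèmes d'Euler p-adiques et
théorie d'Iwasawa*, Ann. Inst. Fourier 48 (1998), §3.1.2, Prop. 3.1.6) evaluates the global
cocycle of the derivative class at the tame generator `τ` through EXPLICIT coboundary witnesses.
This file supplies the generic witnesses, for a topological representation `X` of `G` and an open
normal subgroup `N`: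
* `exists_extend_of_forall_conjMap_eq` — THEOREM A3's descent with the cocycle exposed: an
  `N`-cocycle `ψ` with `G`-invariant class (and `X^N = 0`) EXTENDS ON THE NOSE to a global
  continuous cocycle `Φ` (`Φ|_N = ψ`), and `Φ(g)` is THE element with
  `g·ψ(g⁻¹ n g) − ψ(n) = n·Φ(g) − Φ(g)` — so `κ_r(g)` is computable from witnesses;
* `smul_apply_conj_sub_apply` (C-a) — for a GLOBAL cocycle `Φ` and any `g, u`:
  `g·Φ(g⁻¹ u g) − Φ(u) = u·Φ(g) − Φ(g)`: the witness of `g · res[Φ] = res[Φ]` is `Φ(g)`;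
  `apply_eq_of_forall_witness` — conversely a witness on `N` IS `Φ(g)` when `X^N = 0`;
* `conj_pullback_mul`, `conj_pullback_iterate` — `g · (h · ψ) = (gh) · ψ` EXACTLY on cocycles;
* `sum_zsmul_sub_telescope` — the telescoping identity behind F1's
  `(σ − 1) D_σ = (N − 1) σ^N + 1 − N_σ`, for any sequence `t` in an abelian group:
  `Σ_{i<N} i•(t(i+1) − t(i)) = (N − 1)•t(N) + t(0) − Σ_{i<N} t(i)`.
File C2 (`KolyvaginDerivativeSingularValue`) combines them into the value of the derivative
cocycle at `τ` ([PerrinRiou98] §3.1.2).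

References: B. Perrin-Riou, Ann. Inst. Fourier 48 (1998) 1231–1307, §3.1; K. Rubin, *Euler
Systems* (2000), §4.4, Thm. 4.5.4; J.-P. Serre, *Galois Cohomology*, I §2, I §5.
-/

noncomputable section

open CategoryTheory Function Finset Field
open Literature.NumberTheory.GaloisRepresentations
open Literature.NumberTheory.EllipticCurves (subgroupConj subgroupConj_apply_coe subgroupConj_one)

universe u v

namespace Summit.BirchSwinnertonDyer.Rank1Residual.GaloisImage

namespace Derivative

section Witness

variable {R : Type v} [CommRing R] [TopologicalSpace R]
variable {G : Type u} [Group G] [TopologicalSpace G] [IsTopologicalGroup G]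
variable (X : TopRep.{u} R G) (N : Subgroup G) [N.Normal]

/-! ### §1 THEOREM A3's descent with the global cocycle exposed -/

/-- **Extension on the nose** ([Serre], I §2.6 (b); [PerrinRiou98] §3.1.2 "se prolonge de manière
unique en un élément de `Z¹(G, A)` dont la restriction à `H` est `D(x)`").  For an open normal `N`,
`X^N = 0`, and an `N`-cocycle `ψ` whose class is fixed by every `g ∈ G`, there is a GLOBAL
continuous cocycle `Φ` with `Φ(n) = ψ(n)` for all `n ∈ N`, whose value at any `g ∈ G` satisfies
`g·ψ(g⁻¹ n g) − ψ(n) = n·Φ(g) − Φ(g)` for all `n ∈ N` (and is the unique such element).  This is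
the construction inside F4's `existsUnique_resSubgroup_eq_of_forall_conjMap_eq`, exported.
[cite: SerreGaloisCohomology1997, I §2.6 (b)] -/
theorem exists_extend_of_forall_conjMap_eq (hN : IsOpen (N : Set G))
    (h0 : ∀ v : X, (∀ n : N, X.ρ (n : G) v = v) → v = 0)
    (ψ : contOneCocycles (subgroupRep X N))
    (hψ : ∀ g : G, conjMap X N g 1 (oneCocycleClass _ ψ) = oneCocycleClass _ ψ) :
    ∃ Φ : contOneCocycles X, (∀ n : N, Φ.1 n = ψ.1 n) ∧
      ∀ (g : G) (n : N), X.ρ g (ψ.1 (subgroupConj N g n)) - ψ.1 n = X.ρ (n : G) (Φ.1 g) - Φ.1 g := by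
  have hex : ∀ g : G, ∃ m : X, ∀ n : N,
      X.ρ g (ψ.1 (subgroupConj N g n)) - ψ.1 n = X.ρ (n : G) m - m :=
    fun g => exists_conj_sub_eq X N g ψ (hψ g)
  choose m hm using hex
  have huniq : ∀ g (v : X), (∀ n : N, X.ρ g (ψ.1 (subgroupConj N g n)) - ψ.1 n = X.ρ (n : G) v - v) →
      v = m g := fun g v hv => eq_of_forall_rho_sub_eq X N h0 fun n => by rw [← hv n, hm g n]
  have hmN : ∀ n₀ : N, m n₀ = ψ.1 n₀ := fun n₀ =>
    (huniq n₀ (ψ.1 n₀) fun n => conj_sub_eq_of_mem X N ψ n₀ n).symm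
  have hmul : ∀ g h : G, m (g * h) = m g + X.ρ g (m h) := by
    intro g h
    refine (huniq (g * h) _ fun n => ?_).symm
    have hconj : subgroupConj N (g * h) n = subgroupConj N h (subgroupConj N g n) :=
      Subtype.ext (by simp only [subgroupConj_apply_coe, mul_inv_rev, mul_assoc])
    have hh := hm h (subgroupConj N g n)
    rw [sub_eq_iff_eq_add] at hh
    have hg := hm g n
    rw [sub_eq_iff_eq_add] at hg
    rw [hconj, ρ_mul_apply, hh, map_add, hg, map_sub, subgroupConj_apply_coe, ← ρ_mul_apply,
      show g * (g⁻¹ * ↑n * g) = ↑n * g by group, ρ_mul_apply]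
    simp only [map_add]
    abel
  have hcontN : ContinuousOn m (N : Set G) := by
    rw [continuousOn_iff_continuous_restrict]
    have : (N : Set G).restrict m = fun n : N => ψ.1 n := funext fun n => hmN n
    rw [this]
    exact ψ.1.continuous
  have hcont1 : ContinuousAt m 1 := hcontN.continuousAt (hN.mem_nhds N.one_mem)
  have hcont : Continuous m := by
    rw [continuous_iff_continuousAt]
    intro g₀
    have heq : m = fun x => m g₀ + X.ρ g₀ (m (g₀⁻¹ * x)) := funext fun x => by
      rw [← hmul, mul_inv_cancel_left]
    rw [heq]
    refine continuousAt_const.add ((X.ρ g₀).continuous.continuousAt.comp ?_)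
    have h1 : ContinuousAt m (g₀⁻¹ * g₀) := by rw [inv_mul_cancel]; exact hcont1
    exact h1.comp (continuous_const.mul continuous_id).continuousAt
  exact ⟨⟨⟨m, hcont⟩, fun g h => hmul g h⟩, hmN, fun g n => hm g n⟩

omit [N.Normal] in
/-- The class of an extension on the nose restricts to the class of `ψ`. [folklore] -/
theorem resSubgroup_oneCocycleClass_eq_of_extend (Φ : contOneCocycles X)
    (ψ : contOneCocycles (subgroupRep X N)) (hΦ : ∀ n : N, Φ.1 n = ψ.1 n) :
    resSubgroup X N 1 (oneCocycleClass X Φ) = oneCocycleClass _ ψ := by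
  rw [resSubgroup_oneCocycleClass]
  exact congrArg _ (Subtype.ext (ContinuousMap.ext fun n => hΦ n))

/-! ### §2 The witness of a GLOBAL cocycle is its value -/

omit [IsTopologicalGroup G] in
/-- **(C-a) The witness of `g · res[Φ] = res[Φ]` for a GLOBAL cocycle is `Φ(g)`**:
`g·Φ(g⁻¹ u g) − Φ(u) = u·Φ(g) − Φ(g)` for every `u` (expand `Φ(g⁻¹ u g)` by the cocycle identity
twice; `g·Φ(g⁻¹) = −Φ(g)`).  [PerrinRiou98] §3.1.2. [folklore] -/
theorem smul_apply_conj_sub_apply (Φ : contOneCocycles X) (g u : G) :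
    X.ρ g (Φ.1 (g⁻¹ * u * g)) - Φ.1 u = X.ρ u (Φ.1 g) - Φ.1 g := by
  have h1 : Φ.1 (g⁻¹ * u * g) = Φ.1 (g⁻¹ * u) + X.ρ (g⁻¹ * u) (Φ.1 g) := Φ.2 (g⁻¹ * u) g
  have h2 : Φ.1 (g⁻¹ * u) = Φ.1 g⁻¹ + X.ρ g⁻¹ (Φ.1 u) := Φ.2 g⁻¹ u
  have h3 : X.ρ g (Φ.1 g⁻¹) = -Φ.1 g := by
    have h := Φ.2 g g⁻¹
    rw [mul_inv_cancel, contOneCocycles.apply_one] at h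
    rw [eq_neg_iff_add_eq_zero, add_comm]
    exact h.symm
  rw [h1, h2, map_add, map_add, h3, ρ_apply_ρ_inv_apply, ← ρ_mul_apply, ← mul_assoc,
    mul_inv_cancel, one_mul]
  abel

/-- (C-a) with the subgroup bookkeeping: `g·Φ(g⁻¹ u g) − Φ(u) = u·Φ(g) − Φ(g)` for `u ∈ N`
(`subgroupConj N g u = g⁻¹ u g`). [folklore] -/
theorem smul_apply_subgroupConj_sub_apply (Φ : contOneCocycles X) (g : G) (u : N) :
    X.ρ g (Φ.1 (subgroupConj N g u : N)) - Φ.1 u = X.ρ (u : G) (Φ.1 g) - Φ.1 g := by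
  rw [subgroupConj_apply_coe]
  exact smul_apply_conj_sub_apply X Φ g u

/-- **A witness IS the value** ([PerrinRiou98] §3.1.2, uniqueness): if `X^N = 0`, `Φ` is a global
cocycle, and `m` satisfies `g·Φ(g⁻¹ u g) − Φ(u) = u·m − m` for all `u ∈ N`, then `m = Φ(g)`.
This is how the value `κ(τ)` of a derivative class is read off from an explicit coboundary.
[folklore] -/
theorem apply_eq_of_forall_witness (h0 : ∀ v : X, (∀ n : N, X.ρ (n : G) v = v) → v = 0)
    (Φ : contOneCocycles X) (g : G) (m : X)
    (hm : ∀ u : N, X.ρ g (Φ.1 (subgroupConj N g u : N)) - Φ.1 u = X.ρ (u : G) m - m) :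
    Φ.1 g = m :=
  eq_of_forall_rho_sub_eq X N h0 fun u => by
    rw [← smul_apply_subgroupConj_sub_apply X N Φ g u, hm u]

/-! ### §3 Conjugation of cocycles composes exactly -/

/-- **Composition of conjugations on cocycles is exact**: `g · (h · ψ) = (gh) · ψ` as cocycles
(not only as classes). [folklore] -/
theorem conj_pullback_mul (g h : G) (ψ : contOneCocycles (subgroupRep X N)) :
    contOneCocycles.pullback (subgroupConj N g) (conjRepHom X N g)
        (contOneCocycles.pullback (subgroupConj N h) (conjRepHom X N h) ψ) =
      contOneCocycles.pullback (subgroupConj N (g * h)) (conjRepHom X N (g * h)) ψ := by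
  refine Subtype.ext (ContinuousMap.ext fun u => ?_)
  have hc : subgroupConj N h (subgroupConj N g u) = subgroupConj N (g * h) u :=
    Subtype.ext (by simp only [subgroupConj_apply_coe, mul_inv_rev, mul_assoc])
  rw [conj_pullback_apply, conj_pullback_apply, conj_pullback_apply, ρ_mul_apply, hc]

/-- Iterated conjugation: `σ · (σ · … (σ · ψ)) = σ^i · ψ` (`i` times). [folklore] -/
theorem conj_pullback_iterate (σ : G) (ψ : contOneCocycles (subgroupRep X N)) (i : ℕ) :
    (fun φ => contOneCocycles.pullback (subgroupConj N σ) (conjRepHom X N σ) φ)^[i] ψ =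
      contOneCocycles.pullback (subgroupConj N (σ ^ i)) (conjRepHom X N (σ ^ i)) ψ := by
  induction i with
  | zero =>
    rw [Function.iterate_zero, id_eq, pow_zero]
    refine Subtype.ext (ContinuousMap.ext fun u => ?_)
    rw [conj_pullback_apply, map_one, subgroupConj_one]
    rfl
  | succ i ih =>
    rw [Function.iterate_succ', Function.comp_apply, ih, conj_pullback_mul, ← pow_succ']

/-- Values of iterated conjugates: `(σ^{i} · ψ)` at `σ⁻¹ u σ` is `σ⁻¹` of `(σ^{i+1} · ψ)(u)`, i.e.
`σ · (σ^i u σ^{-i}-twist)`: `σ (σ^i ψ(σ^{-i} (σ⁻¹ u σ) σ^i)) = σ^{i+1} ψ(σ^{-(i+1)} u σ^{i+1})`.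
[folklore] -/
theorem rho_rho_pow_apply_subgroupConj (σ : G) (ψ : contOneCocycles (subgroupRep X N)) (i : ℕ)
    (u : N) :
    X.ρ σ (X.ρ (σ ^ i) (ψ.1 (subgroupConj N (σ ^ i) (subgroupConj N σ u)))) =
      X.ρ (σ ^ (i + 1)) (ψ.1 (subgroupConj N (σ ^ (i + 1)) u)) := by
  rw [← ρ_mul_apply, ← pow_succ']
  congr 2
  exact Subtype.ext (by simp only [subgroupConj_apply_coe, pow_succ', mul_inv_rev, mul_assoc])

/-! ### §4 The telescoping identity -/

/-- **Telescoping** (the identity behind F1's `(σ − 1) D_σ = (N−1) σ^N + 1 − N_σ`), for any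
sequence `t` in an abelian group: `Σ_{i<N} i • (t(i+1) − t(i)) = (N − 1) • t(N) + t(0) − Σ_{i<N} t(i)`
(as `ℤ`-multiples).  Applied in file C2 to `t(i) = σ^i · y(σ^{-i} u σ^i)`. [folklore] -/
theorem sum_zsmul_sub_telescope {M : Type*} [AddCommGroup M] (t : ℕ → M) (N : ℕ) :
    ∑ i ∈ range N, (i : ℤ) • (t (i + 1) - t i) =
      ((N : ℤ) - 1) • t N + t 0 - ∑ i ∈ range N, t i := by
  induction N with
  | zero => simp
  | succ N ih =>
    rw [sum_range_succ, sum_range_succ, ih]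
    push_cast
    module

end Witness

end Derivative

end Summit.BirchSwinnertonDyer.Rank1Residual.GaloisImage

end
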